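import Summits.AtomisticToContinuum.BoseEinsteinCondensation.Theorems.BECInsertionCorrectorCorrectorClosureLongWaveStructureOfSRBMinimiser
import Literature.MathematicalPhysics.QuantumManyBody.CondensateOccupationStability
import HarnessLib

/-!
# Crux `CorrectorClosure` (stmt-AtomisticToContinuum-12058), line `volume-homotopy-sum-rule-domination` —
# registered stub `stub_concentrationOfMoments`, auxiliary file 1/2: phase rigidity of torus minimisers

Supports (does not close) stmt-AtomisticToContinuum-12058, route `BECInsertionCorrector`.

The zero-mode moment module of skeleton v3 (stubs S3a/S3b/S3g) speaks about the REAL, POSITIVE `C³`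
minimiser `Φ` of the periodic `(n+2)`-body energy (`PositiveMinimiser_proof`, item 11787), while the
concentration inequality 12616′ is asserted for EVERY exact minimiser `Ψ`.  This file upgrades the
rigidity of the modulus (`norm_eq_norm_of_minimisers`, wave 1) to rigidity of the state:

* `cm_exists_phase_eq_of_minimisers` — for a smooth-class potential, `N ≥ 1`, `L > 0`, two exact
  minimisers `Ψ, Θ` (finite energy) satisfy `Ψ = c Θ` pointwise for ONE unit complex number `c`.
  Proof: nondegeneracy in Ky Fan form (`PeriodicGroundStateNondegenerate_holds`) and clustering modulo a
  phase (`exists_phase_integral_norm_sub_sq_le_of_kyFanGap`) give, for every `η > 0`, a phase `θ_η` with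
  `∫_cell |Ψ − e^{iθ_η}Θ|² ≤ η`; the explicit formula `∫_cell |Ψ − cΘ|² = 2 − 2 Re(c̄⟨Θ,Ψ⟩)` for `|c| = 1`
  (`cm_integral_norm_sub_mul_sq`) turns this into `|⟨Θ,Ψ⟩| ≥ 1`, whence the choice `c = ⟨Θ,Ψ⟩/|⟨Θ,Ψ⟩|`
  makes the integral vanish, and a continuous periodic function with vanishing `L²` norm on the cell
  vanishes (`IsTorusPeriodic.eq_zero_of_lintegral_normSq_eq_zero`);
* `cm_pairTerm_const_mul` — the pair integral `∫_{cell^n} |∫∫ Ψ(x,y,·)|²` of 12616′ is invariant under a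
  global phase (as is `condensateOccupation`, `condensateOccupation_const_mul_of_norm_eq_one`).

## References

* [ReedSimonIV1978] M. Reed, B. Simon, *Methods of Modern Mathematical Physics IV*, §XIII.12,
  Thms XIII.43–XIII.47 (nondegenerate ground state of the torus Bose gas).
-/

noncomputable section

open MeasureTheory Filter Matrix
open scoped ENNReal NNReal BigOperators ComplexConjugate

namespace Summit.AtomisticToContinuum.BoseEinsteinCondensation.Theorems.CorrectorClosure.VolumeHomotopySumRuleDomination

open Literature.MathematicalPhysics.QuantumManyBody
open Literature.MathematicalPhysics.QuantumManyBody.BoseGas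

variable {N : ℕ} {L : ℝ}

/-! ### The distance to a phase multiple -/

/-- `|a − c b|² = |a|² + |b|² − 2 Re(c̄ b̄ a)` for a unit complex number `c`. [folklore] -/
theorem cm_norm_sub_mul_sq (a b : ℂ) {c : ℂ} (hc : ‖c‖ = 1) :
    ‖a - c * b‖ ^ 2 = ‖a‖ ^ 2 + ‖b‖ ^ 2 - 2 * (conj c * (conj b * a)).re := by
  have hcb : Complex.normSq (c * b) = Complex.normSq b := by
    rw [Complex.normSq_eq_norm_sq, Complex.normSq_eq_norm_sq, norm_mul, hc, one_mul]
  have hre : (a * conj (c * b)).re = (conj c * (conj b * a)).re := by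
    rw [map_mul]
    congr 1
    ring
  rw [Complex.sq_norm, Complex.sq_norm, Complex.sq_norm, Complex.normSq_sub, hcb, hre]

/-- **The distance of a state to a phase multiple of another.** For periodic trial states `Ψ, Θ`
(normalised on the cell) and a unit complex number `c`:
`∫_{[0,L)^{3N}} |Ψ − cΘ|² = 2 − 2 Re(c̄ ⟨Θ, Ψ⟩_cell)`. [folklore] -/
theorem cm_integral_norm_sub_mul_sq (Ψ Θ : PeriodicTrialState N L) {c : ℂ} (hc : ‖c‖ = 1) :
    ∫ X in cellN N L, ‖Ψ.ψ X - c * Θ.ψ X‖ ^ 2 =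
      2 - 2 * (conj c * ∫ X in cellN N L, conj (Θ.ψ X) * Ψ.ψ X).re := by
  have hΨc : Continuous Ψ.ψ := Ψ.contDiff.continuous
  have hΘc : Continuous Θ.ψ := Θ.contDiff.continuous
  simp_rw [cm_norm_sub_mul_sq _ _ hc]
  have h1 : Integrable (fun X => ‖Ψ.ψ X‖ ^ 2) (volume.restrict (cellN N L)) :=
    integrableOn_cellN (hΨc.norm.pow 2) L
  have h2 : Integrable (fun X => ‖Θ.ψ X‖ ^ 2) (volume.restrict (cellN N L)) :=
    integrableOn_cellN (hΘc.norm.pow 2) L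
  have h3c : Continuous fun X => conj c * (conj (Θ.ψ X) * Ψ.ψ X) :=
    continuous_const.mul ((Complex.continuous_conj.comp hΘc).mul hΨc)
  have h3 : Integrable (fun X => 2 * (conj c * (conj (Θ.ψ X) * Ψ.ψ X)).re)
      (volume.restrict (cellN N L)) :=
    integrableOn_cellN (continuous_const.mul (Complex.continuous_re.comp h3c)) L
  have h12 : Integrable (fun X => ‖Ψ.ψ X‖ ^ 2 + ‖Θ.ψ X‖ ^ 2) (volume.restrict (cellN N L)) :=
    h1.add h2
  rw [integral_sub h12 h3, integral_add h1 h2, integral_const_mul]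
  have hΨ1 : ∫ X in cellN N L, ‖Ψ.ψ X‖ ^ 2 = 1 := by
    rw [integral_cellN_norm_sq_eq_toReal L hΨc, Ψ.norm_eq, ENNReal.toReal_one]
  have hΘ1 : ∫ X in cellN N L, ‖Θ.ψ X‖ ^ 2 = 1 := by
    rw [integral_cellN_norm_sq_eq_toReal L hΘc, Θ.norm_eq, ENNReal.toReal_one]
  have h4 := integral_re (integrableOn_cellN h3c L)
  simp only [RCLike.re_to_complex] at h4
  rw [integral_const_mul] at h4
  rw [hΨ1, hΘ1, h4]
  norm_num

/-! ### Phase rigidity -/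

/-- **Phase rigidity of torus minimisers.** For a smooth-class potential (finite, `C²`-radial; finite
range), `N ≥ 1`, `L > 0`: two exact minimisers `Ψ, Θ` of the periodic `N`-body energy (finite
ground-state energy) differ by a global phase, `Ψ = cΘ` with `|c| = 1` — the bosonic torus ground
state is nondegenerate (Ky Fan gap), minimisers cluster modulo a phase for every tolerance, the
distance to the optimal phase multiple is `2 − 2|⟨Θ,Ψ⟩| ≤ 0`, and a continuous periodic function with
vanishing `L²` norm on the cell vanishes identically. [folklore] -/
theorem cm_exists_phase_eq_of_minimisers {v : ℝ → ℝ≥0∞} (hv : IsRepulsiveFiniteRange v)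
    (hfin : ∀ r, v r ≠ ⊤) (hC2 : ContDiff ℝ 2 (fun x : Space => (v ‖x‖).toReal)) (hN : 1 ≤ N)
    (hL : 0 < L) (Ψ Θ : PeriodicTrialState N L)
    (hΨ : periodicEnergy v Ψ = periodicGroundStateEnergy v N L)
    (hΘ : periodicEnergy v Θ = periodicGroundStateEnergy v N L) (hΘfin : periodicEnergy v Θ ≠ ⊤) :
    ∃ c : ℂ, ‖c‖ = 1 ∧ ∀ X, Ψ.ψ X = c * Θ.ψ X := by
  obtain ⟨hmeas, R₀, hR₀⟩ := hv
  obtain ⟨M, hM⟩ := exists_bound_of_continuous_finiteRange hfin hC2.continuous hR₀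
  obtain ⟨C, hC⟩ := exists_bound_periodizedPotential_of_space hL hM hR₀
  have hND := PeriodicGroundStateNondegenerate_holds N L v hN hL hmeas ⟨C, hC⟩
  have hE : periodicGroundStateEnergy v N L ≠ ⊤ := hΘ ▸ hΘfin
  obtain ⟨γ, hγ, hgap⟩ : ∃ γ : ℝ, 0 < γ ∧
      2 * periodicGroundStateEnergy v N L + ENNReal.ofReal γ ≤ kyFanTwo v N L := by
    obtain ⟨r, hr, hlt⟩ := ENNReal.lt_iff_exists_add_pos_lt.1 hND
    exact ⟨r, NNReal.coe_pos.2 hr, by rw [ENNReal.ofReal_coe_nnreal]; exact hlt.le⟩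
  -- the overlap `s = ⟨Θ, Ψ⟩_cell` has modulus at least one
  set s : ℂ := ∫ X in cellN N L, conj (Θ.ψ X) * Ψ.ψ X with hs
  have hη : ∀ η : ℝ, 0 < η → 2 - 2 * ‖s‖ ≤ η := by
    intro η hη
    obtain ⟨δ, -, hclus⟩ := exists_phase_integral_norm_sub_sq_le_of_kyFanGap hmeas hγ hE hgap hη
    obtain ⟨θ, hθ⟩ := hclus Ψ Θ (hΨ ▸ le_self_add) (hΘ ▸ le_self_add)
    have hc1 : ‖Complex.exp (θ * Complex.I)‖ = 1 := Complex.norm_exp_ofReal_mul_I θ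
    rw [cm_integral_norm_sub_mul_sq Ψ Θ hc1] at hθ
    have hre : (conj (Complex.exp (θ * Complex.I)) * s).re ≤ ‖s‖ := by
      refine (Complex.re_le_norm _).trans_eq ?_
      rw [norm_mul, Complex.norm_conj, hc1, one_mul]
    linarith
  have hs1 : 1 ≤ ‖s‖ := by
    by_contra h
    rw [not_le] at h
    have := hη ((2 - 2 * ‖s‖) / 2) (by linarith)
    linarith
  have hsn : (0 : ℝ) < ‖s‖ := by linarith
  -- the optimal phase
  set c : ℂ := ((‖s‖⁻¹ : ℝ) : ℂ) * s with hc_def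
  have hc : ‖c‖ = 1 := by
    rw [hc_def, norm_mul, Complex.norm_real, Real.norm_of_nonneg (inv_nonneg.2 hsn.le),
      inv_mul_cancel₀ hsn.ne']
  have hcs : (conj c * s).re = ‖s‖ := by
    have h1 : conj c * s = ((‖s‖ : ℝ) : ℂ) := by
      rw [hc_def, map_mul, Complex.conj_ofReal, mul_assoc, Complex.conj_mul', ← Complex.ofReal_pow,
        ← Complex.ofReal_mul, sq, ← mul_assoc, inv_mul_cancel₀ hsn.ne', one_mul]
    rw [h1, Complex.ofReal_re]
  have hint0 : ∫ X in cellN N L, ‖Ψ.ψ X - c * Θ.ψ X‖ ^ 2 = 0 := by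
    refine le_antisymm ?_ (integral_nonneg fun X => sq_nonneg _)
    rw [cm_integral_norm_sub_mul_sq Ψ Θ hc, hcs]
    linarith
  -- vanishing of the continuous periodic remainder
  have hΨc : Continuous Ψ.ψ := Ψ.contDiff.continuous
  have hΘc : Continuous Θ.ψ := Θ.contDiff.continuous
  have hrc : Continuous fun X => Ψ.ψ X - c * Θ.ψ X := hΨc.sub (continuous_const.mul hΘc)
  have hper : IsTorusPeriodic L fun X => Ψ.ψ X - c * Θ.ψ X := fun Y i k => by
    simp only [Ψ.periodic, Θ.periodic]
  have h0 : ∫⁻ X in cellN N L, ((‖Ψ.ψ X - c * Θ.ψ X‖₊ : ℝ≥0∞)) ^ 2 = 0 := by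
    rw [lintegral_cellN_nnnorm_sq_eq_ofReal L hrc, hint0, ENNReal.ofReal_zero]
  refine ⟨c, hc, fun X => ?_⟩
  exact sub_eq_zero.1 (hper.eq_zero_of_lintegral_normSq_eq_zero hL hrc h0 X)

/-- **Every minimiser is a phase multiple of the positive one.** For a smooth-class potential, every
exact minimiser `Ψ` of the periodic `(n+1)`-body energy at side `L > 0` is `c Φ`, `|c| = 1`, for the
real non-negative nowhere-vanishing `C³` minimiser `Φ` of `PositiveMinimiser_proof` (item 11787).
[folklore] -/
theorem cm_exists_positive_phase {v : ℝ → ℝ≥0∞} (hv : IsRepulsiveFiniteRange v)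
    (hfin : ∀ r, v r ≠ ⊤) (hC2 : ContDiff ℝ 2 (fun x : Space => (v ‖x‖).toReal))
    (hedge : ∃ Cₑ : ℝ, ∀ x : Space,
      ‖iteratedFDeriv ℝ 2 (fun x : Space => (v ‖x‖).toReal) x‖ ≤ Cₑ * Real.sqrt ((v ‖x‖).toReal))
    {n : ℕ} (hL : 0 < L) (Ψ : PeriodicTrialState (n + 1) L)
    (hΨ : periodicEnergy v Ψ = periodicGroundStateEnergy v (n + 1) L) :
    ∃ Φ : PeriodicTrialState (n + 1) L,
      periodicEnergy v Φ = periodicGroundStateEnergy v (n + 1) L ∧ periodicEnergy v Φ ≠ ⊤ ∧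
      ContDiff ℝ 3 Φ.ψ ∧ (∀ X, Φ.ψ X = (‖Φ.ψ X‖ : ℂ)) ∧ (∀ X, Φ.ψ X ≠ 0) ∧
      ∃ c : ℂ, ‖c‖ = 1 ∧ ∀ X, Ψ.ψ X = c * Φ.ψ X := by
  obtain ⟨Φ, hΦE, hΦfin, hΦ3, hΦreal, hΦne⟩ :=
    Summit.AtomisticToContinuum.BoseEinsteinCondensation.Theorems.PositiveMinimiser_proof v hv hfin hC2
      hedge n L hL
  exact ⟨Φ, hΦE, hΦfin, hΦ3, hΦreal, hΦne,
    cm_exists_phase_eq_of_minimisers hv hfin hC2 (Nat.succ_le_succ (Nat.zero_le n)) hL Ψ Φ hΨ hΦE hΦfin⟩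

/-! ### Phase invariance of the pair integral of 12616′ -/

/-- **Phase invariance of the pair integral**: `∫_{cell^n} |∫_cell∫_cell (cΦ)(x,y,·) dx dy|²` does not
depend on the unit complex number `c`. [folklore] -/
theorem cm_pairTerm_const_mul {n : ℕ} (L : ℝ) {c : ℂ} (hc : ‖c‖ = 1) (Φ : Config (n + 2) → ℂ) :
    ∫⁻ Y in cellN n L,
        (‖∫ x in cell L, ∫ y in cell L, c * Φ (vecCons x (vecCons y Y))‖₊ : ℝ≥0∞) ^ 2 =
      ∫⁻ Y in cellN n L,
        (‖∫ x in cell L, ∫ y in cell L, Φ (vecCons x (vecCons y Y))‖₊ : ℝ≥0∞) ^ 2 := by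
  refine lintegral_congr fun Y => ?_
  have h : (∫ x in cell L, ∫ y in cell L, c * Φ (vecCons x (vecCons y Y))) =
      c * ∫ x in cell L, ∫ y in cell L, Φ (vecCons x (vecCons y Y)) := by
    simp_rw [integral_const_mul]
  have h1 : ((‖c‖₊ : ℝ≥0∞)) ^ 2 = 1 := by
    rw [coe_nnnorm_sq_eq_ofReal, hc, one_pow, ENNReal.ofReal_one]
  rw [h, nnnorm_mul, ENNReal.coe_mul, mul_pow, h1, one_mul]

end Summit.AtomisticToContinuum.BoseEinsteinCondensation.Theorems.CorrectorClosure.VolumeHomotopySumRuleDomination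

end
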